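import Mathlib.Analysis.Complex.CauchyIntegral
import Mathlib.Analysis.Calculus.Deriv.Slope
import Mathlib.Analysis.Analytic.Basic
import Mathlib.Analysis.Calculus.FormalMultilinearSeries
import Mathlib.Analysis.SpecificLimits.Basic
import Mathlib.Tactic
import HarnessLib

/-!
# The basic arithmetic holonomy bound, III: the Cauchy estimate at the lowest order

Calegari–Dimitrov–Tang, arXiv:2408.15403, **Appendix §17.3 "Diophantine analysis of the lowest
order coefficient"** (p. 130): if `F(x) = Σ_k β_k x^k` vanishes to order `n` at `x = 0` and
`V(z) := h(z) u(z)^D F(φ(z))` (`φ = v/u`, `u(0) = h(0) = 1`) is holomorphic on a neighbourhood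
of the closed unit disc, then the leading term of `V` is `φ'(0)ⁿ βₙ zⁿ`, and Cauchy's formula on
`|z| = 1` (eq. (Cauchy bound)) gives the **Liouville-type upper bound**
`|βₙ| · |φ'(0)|ⁿ ≤ sup_𝕋 |V|` (eq. (sup bound), first line).

This file proves exactly that, for arbitrary complex coefficients:

* `HolonomyBound.tendsto_div_pow_coeff`, `HolonomyBound.coeff_eq_of_tendsto_div_pow` — the
  Taylor coefficients of a holomorphic `V` at `0` below `n` vanish and the `n`-th equals `L`
  as soon as `V(z)/zⁿ → L` (`z → 0`, `z ≠ 0`).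
* `HolonomyBound.norm_coeff_mul_pow_le_of_eq_mul` — **the estimate, meromorphic form**: if
  `β_k = 0` for `k < n`, `φ` is differentiable at `0` with `φ(0) = 0`, `U(z) = Σ β_k φ(z)^k`
  near `0`, `V` is holomorphic on `|z| < R₀` (`R₀ > 1`) with `V = w · U` near `0` for a factor
  `w` continuous at `0` with `w(0) = 1`, and `|V| ≤ S` on `|z| = 1`, then `‖βₙ‖ · ‖φ'(0)‖ⁿ ≤ S`.
* `HolonomyBound.norm_coeff_mul_pow_le` — the holomorphic case `w = 1`, `U = V`, `φ`
  holomorphic on `|z| < R₀`.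

No named facts. (Sequel: the assembly of the bound `m ≤ 2 sup_𝕋 log⁺|φ| / (log|φ'(0)| − Σbᵢ)`.)

## References

* [CalegariDimitrovTang2024] arXiv:2408.15403, Appendix §17.3, eqs. (Cauchy bound), (sup bound)
  (p. 130).
-/

noncomputable section

open Filter Metric Asymptotics Finset
open scoped Topology

namespace Literature.NumberTheory.Transcendental

namespace HolonomyBound

/-! ### Taylor coefficients as limits of `V(z)/z^k` -/

/-- If `f` has the (scalar) power series `p` at `0` and its coefficients below `k` vanish, then
`f(z)/z^k → p.coeff k` as `z → 0`, `z ≠ 0` (from `f(y) − Σ_{j≤k} p_j y^j = O(|y|^{k+1})`).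
[folklore] -/
theorem tendsto_div_pow_coeff {f : ℂ → ℂ} {p : FormalMultilinearSeries ℂ ℂ ℂ}
    (hf : HasFPowerSeriesAt f p 0) {k : ℕ} (hk : ∀ j < k, p.coeff j = 0) :
    Tendsto (fun z => f z / z ^ k) (𝓝[≠] 0) (𝓝 (p.coeff k)) := by
  have hO := hf.isBigO_sub_partialSum_pow (k + 1)
  have hps : ∀ y : ℂ, p.partialSum (k + 1) y = y ^ k * p.coeff k := by
    intro y
    rw [FormalMultilinearSeries.partialSum, Finset.sum_range_succ, Finset.sum_eq_zero, zero_add,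
      FormalMultilinearSeries.apply_eq_pow_smul_coeff, smul_eq_mul]
    intro j hj
    rw [FormalMultilinearSeries.apply_eq_pow_smul_coeff, hk j (Finset.mem_range.mp hj), smul_zero]
  simp only [zero_add, hps] at hO
  obtain ⟨C, hC⟩ := hO.bound
  -- the error term divided by `z^k` tends to `0`
  have hg : Tendsto (fun y : ℂ => (f y - y ^ k * p.coeff k) / y ^ k) (𝓝[≠] 0) (𝓝 0) := by
    refine squeeze_zero_norm' (a := fun y => C * ‖y‖) ?_ ?_
    · have hC' : ∀ᶠ y : ℂ in 𝓝[≠] 0, ‖f y - y ^ k * p.coeff k‖ ≤ C * ‖‖y‖ ^ (k + 1)‖ :=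
        hC.filter_mono nhdsWithin_le_nhds
      filter_upwards [hC', self_mem_nhdsWithin] with y hy hy0
      have hy0' : 0 < ‖y‖ := norm_pos_iff.mpr hy0
      rw [norm_div, norm_pow, div_le_iff₀ (pow_pos hy0' k)]
      calc ‖f y - y ^ k * p.coeff k‖ ≤ C * ‖‖y‖ ^ (k + 1)‖ := hy
        _ = C * ‖y‖ * ‖y‖ ^ k := by
            rw [Real.norm_of_nonneg (by positivity), pow_succ]; ring
    · have : Tendsto (fun y : ℂ => C * ‖y‖) (𝓝 0) (𝓝 (C * ‖(0 : ℂ)‖)) :=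
        (continuous_const.mul continuous_norm).tendsto 0
      rw [norm_zero, mul_zero] at this
      exact this.mono_left nhdsWithin_le_nhds
  have h2 := hg.add_const (p.coeff k)
  rw [zero_add] at h2
  refine h2.congr' ?_
  filter_upwards [self_mem_nhdsWithin] with y hy
  have hyk : y ^ k ≠ 0 := pow_ne_zero k hy
  field_simp
  ring

/-- **Reading off the leading coefficient**: if `V` has a power series `p` at `0` and
`V(z)/zⁿ → L` as `z → 0` (`z ≠ 0`), then the coefficients of `p` below `n` vanish and the
`n`-th one is `L`. [folklore] -/
theorem coeff_eq_of_tendsto_div_pow {f : ℂ → ℂ} {p : FormalMultilinearSeries ℂ ℂ ℂ}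
    (hf : HasFPowerSeriesAt f p 0) {n : ℕ} {L : ℂ}
    (hL : Tendsto (fun z => f z / z ^ n) (𝓝[≠] 0) (𝓝 L)) :
    (∀ j < n, p.coeff j = 0) ∧ p.coeff n = L := by
  haveI : NeBot (𝓝[≠] (0 : ℂ)) := NormedField.nhdsNE_neBot 0
  have key : ∀ k, k ≤ n → ∀ j < k, p.coeff j = 0 := by
    intro k
    induction k with
    | zero => intro _ j hj; exact absurd hj (Nat.not_lt_zero j)
    | succ k ih =>
      intro hk j hj
      have ih' := ih (Nat.le_of_succ_le hk)
      rcases Nat.lt_succ_iff_lt_or_eq.mp hj with hlt | rfl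
      · exact ih' j hlt
      · have h1 := tendsto_div_pow_coeff hf ih'
        have hjn : j < n := hk
        have h2 : Tendsto (fun z : ℂ => z ^ (n - j) * (f z / z ^ n)) (𝓝[≠] 0)
            (𝓝 ((0 : ℂ) ^ (n - j) * L)) :=
          (((continuous_pow (n - j)).tendsto (0 : ℂ)).mono_left nhdsWithin_le_nhds).mul hL
        rw [zero_pow (by omega), zero_mul] at h2
        have h3 : (fun z : ℂ => z ^ (n - j) * (f z / z ^ n)) =ᶠ[𝓝[≠] 0]
            fun z => f z / z ^ j := by
          filter_upwards [self_mem_nhdsWithin] with z hz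
          have hzn : z ^ n = z ^ (n - j) * z ^ j := by rw [← pow_add]; congr 1; omega
          have hz1 : z ^ (n - j) ≠ 0 := pow_ne_zero _ hz
          have hz2 : z ^ j ≠ 0 := pow_ne_zero _ hz
          rw [hzn]
          field_simp
        exact tendsto_nhds_unique h1 (h2.congr' h3)
  exact ⟨key n le_rfl, tendsto_nhds_unique (tendsto_div_pow_coeff hf (key n le_rfl)) hL⟩

/-! ### The Cauchy estimate at the lowest order (CDT §17.3) -/

/-- Cauchy's inequality on the unit circle for the `n`-th Taylor coefficient: if `V` is
holomorphic on `|z| < R₀` with `R₀ > 1` and `‖V‖ ≤ S` on `|z| = 1`, then the `n`-th coefficient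
of its Taylor series `p = cauchyPowerSeries V 0 1` has norm `≤ S`. [folklore] -/
theorem norm_coeff_cauchyPowerSeries_le {V : ℂ → ℂ} {S : ℝ}
    (hS : ∀ z : ℂ, ‖z‖ = 1 → ‖V z‖ ≤ S) (n : ℕ) :
    ‖(cauchyPowerSeries V 0 1).coeff n‖ ≤ S := by
  rw [← FormalMultilinearSeries.norm_apply_eq_norm_coef]
  have h := norm_cauchyPowerSeries_le V 0 1 n
  have hint : ∫ θ : ℝ in (0)..2 * Real.pi, ‖V (circleMap 0 1 θ)‖ ≤ S * |2 * Real.pi - 0| := by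
    refine le_trans (le_abs_self _) ?_
    have := intervalIntegral.norm_integral_le_of_norm_le_const (a := 0) (b := 2 * Real.pi)
      (f := fun θ : ℝ => ‖V (circleMap 0 1 θ)‖) (C := S) (fun θ _ => by
        rw [Real.norm_of_nonneg (norm_nonneg _)]
        exact hS _ (by rw [norm_circleMap_zero, abs_one]))
    rw [Real.norm_eq_abs] at this
    exact this
  have hS0 : 0 ≤ S := le_trans (norm_nonneg _) (hS 1 (by simp))
  calc ‖cauchyPowerSeries V 0 1 n‖
      ≤ ((2 * Real.pi)⁻¹ * ∫ θ : ℝ in (0)..2 * Real.pi, ‖V (circleMap 0 1 θ)‖) * |(1 : ℝ)|⁻¹ ^ n :=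
        h
    _ ≤ ((2 * Real.pi)⁻¹ * (S * |2 * Real.pi - 0|)) * |(1 : ℝ)|⁻¹ ^ n := by
        gcongr
    _ = S := by
        rw [sub_zero, abs_of_pos Real.two_pi_pos, abs_one, inv_one, one_pow, mul_one]
        field_simp

/-- **The Cauchy estimate at the lowest order, meromorphic form** (CDT Appendix §17.3,
eqs. (Cauchy bound), (sup bound)): let `β_k = 0` for `k < n`; let `φ` be differentiable at `0`
with `φ(0) = 0`, let `U(z) = Σ_k β_k φ(z)^k` for `z` near `0` (so `U = F ∘ φ`,
`F = Σ β_k x^k`), and let `V` be holomorphic on `|z| < R₀` (`R₀ > 1`) with `V = w · U` near `0`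
for a factor `w` continuous at `0` with `w(0) = 1` (in CDT, `w = h u^D` for `φ = v/u`), so that
the leading term of `V` at `z = 0` is `φ'(0)ⁿ βₙ zⁿ`. If `|V| ≤ S` on the unit circle then
`‖βₙ‖ · ‖φ'(0)‖ⁿ ≤ S`.
[cite: CalegariDimitrovTang2024, Appendix §17.3 eqs. (Cauchy bound), (sup bound) (p. 130)] -/
theorem norm_coeff_mul_pow_le_of_eq_mul {β : ℕ → ℂ} {n : ℕ} (hβ : ∀ k < n, β k = 0)
    {φ U V w : ℂ → ℂ} {R₀ : ℝ} (hR₀ : 1 < R₀)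
    (hφ : DifferentiableAt ℂ φ 0) (hφ0 : φ 0 = 0)
    (hV : DifferentiableOn ℂ V (ball (0 : ℂ) R₀))
    (hgerm : ∀ᶠ z in 𝓝 (0 : ℂ), HasSum (fun k => β k * φ z ^ k) (U z))
    (hVU : ∀ᶠ z in 𝓝 (0 : ℂ), V z = w z * U z) (hw : ContinuousAt w 0) (hw1 : w 0 = 1)
    {S : ℝ} (hS : ∀ z : ℂ, ‖z‖ = 1 → ‖V z‖ ≤ S) :
    ‖β n‖ * ‖deriv φ 0‖ ^ n ≤ S := by
  haveI : NeBot (𝓝[≠] (0 : ℂ)) := NormedField.nhdsNE_neBot 0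
  have hS0 : 0 ≤ S := le_trans (norm_nonneg _) (hS 1 (by simp))
  -- the Taylor series of `V` on the unit disc
  have hball : ball (0 : ℂ) R₀ ∈ 𝓝 (0 : ℂ) := ball_mem_nhds 0 (by linarith)
  have hsub : closedBall (0 : ℂ) ((1 : NNReal) : ℝ) ⊆ ball (0 : ℂ) R₀ := by
    rw [NNReal.coe_one]; exact closedBall_subset_ball hR₀
  have hp : HasFPowerSeriesOnBall V (cauchyPowerSeries V 0 (1 : NNReal)) 0 (1 : NNReal) :=
    (hV.mono hsub).hasFPowerSeriesOnBall one_pos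
  set p := cauchyPowerSeries V 0 (1 : NNReal) with hpdef
  have hcoeffS : ‖p.coeff n‖ ≤ S := by
    rw [hpdef, NNReal.coe_one]
    exact norm_coeff_cauchyPowerSeries_le hS n
  -- the derivative at `0`
  set θ : ℂ := deriv φ 0 with hθ
  have hderiv : HasDerivAt φ θ 0 := hφ.hasDerivAt
  -- trivial cases
  by_cases hθ0 : θ = 0
  · rcases Nat.eq_zero_or_pos n with rfl | hn
    · -- `n = 0`: `β 0 = U 0 = V 0` and `‖V 0‖ = ‖p.coeff 0‖ ≤ S`
      have hsum0 : HasSum (fun k => β k * φ 0 ^ k) (U 0) := hgerm.self_of_nhds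
      have hU0 : U 0 = β 0 := by
        rw [hφ0] at hsum0
        have : HasSum (fun k => β k * (0 : ℂ) ^ k) (β 0) := by
          have := hasSum_single (f := fun k => β k * (0 : ℂ) ^ k) 0 (fun k hk => by
            rw [zero_pow hk, mul_zero])
          simpa using this
        exact hsum0.unique this
      have hV0 : V 0 = β 0 := by
        rw [hVU.self_of_nhds, hw1, one_mul, hU0]
      have hc0 : p.coeff 0 = V 0 := by
        have := hp.coeff_zero (fun _ => 1)
        simpa using this
      rw [pow_zero, mul_one, ← hV0, ← hc0]
      exact hcoeffS
    · rw [hθ0, norm_zero, zero_pow hn.ne', mul_zero]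
      exact hS0
  -- main case `θ ≠ 0`: a point `z₀` near `0` with `φ z₀ ≠ 0` where the germ converges
  have hlin : ∀ᶠ z in 𝓝 (0 : ℂ), ‖φ z - z * θ‖ ≤ ‖θ‖ / 2 * ‖z‖ := by
    have h := hderiv.isLittleO
    have h' := h.def (c := ‖θ‖ / 2) (by positivity)
    filter_upwards [h'] with z hz
    simpa [hφ0, smul_eq_mul, mul_comm] using hz
  have hφne : ∀ᶠ z in 𝓝[≠] (0 : ℂ), φ z ≠ 0 := by
    have h1 : ∀ᶠ z in 𝓝[≠] (0 : ℂ), ‖φ z - z * θ‖ ≤ ‖θ‖ / 2 * ‖z‖ :=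
      hlin.filter_mono nhdsWithin_le_nhds
    filter_upwards [h1, self_mem_nhdsWithin] with z hz hz0 hφz
    rw [hφz, zero_sub, norm_neg, norm_mul] at hz
    have : 0 < ‖z‖ * ‖θ‖ := mul_pos (norm_pos_iff.mpr hz0) (norm_pos_iff.mpr hθ0)
    nlinarith [norm_nonneg z, norm_nonneg θ]
  obtain ⟨z₀, hz₀φ, hz₀sum⟩ : ∃ z₀ : ℂ, φ z₀ ≠ 0 ∧ HasSum (fun k => β k * φ z₀ ^ k) (U z₀) :=
    (hφne.and (hgerm.filter_mono nhdsWithin_le_nhds)).exists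
  set w₀ : ℂ := φ z₀ with hw₀
  have hw₀0 : 0 < ‖w₀‖ := norm_pos_iff.mpr hz₀φ
  -- bounded terms at `w₀`
  obtain ⟨B, hB0, hB⟩ : ∃ B, 0 ≤ B ∧ ∀ k, ‖β k‖ * ‖w₀‖ ^ k ≤ B := by
    obtain ⟨B, hB⟩ := hz₀sum.summable.tendsto_atTop_zero.norm.bddAbove_range
    refine ⟨max B 0, le_max_right _ _, fun k => le_trans ?_ (le_max_left _ _)⟩
    have := hB ⟨k, rfl⟩
    simpa [norm_mul, norm_pow] using this
  -- the tail function `T z = Σ_j β (n+j) (φ z)^j`, for `‖φ z‖ ≤ ‖w₀‖/2`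
  have hcoef : ∀ j, ‖β (n + j)‖ ≤ B * (‖w₀‖⁻¹) ^ (n + j) := by
    intro j
    have h := hB (n + j)
    rw [inv_pow, ← div_eq_mul_inv, le_div_iff₀ (pow_pos hw₀0 _)]
    exact h
  have hsmall : ∀ᶠ z in 𝓝 (0 : ℂ), ‖φ z‖ ≤ ‖w₀‖ / 2 := by
    have hcont : ContinuousAt φ 0 := hderiv.continuousAt
    have : Tendsto (fun z => ‖φ z‖) (𝓝 0) (𝓝 ‖φ 0‖) := hcont.norm
    rw [hφ0, norm_zero] at this
    exact this.eventually (ge_mem_nhds (by positivity))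
  -- for such `z`: summability of the tail, `V z = φ z ^ n * T z`, and `‖T z - β n‖ ≤ K ‖φ z‖`
  set K : ℝ := 2 * B * (‖w₀‖⁻¹) ^ (n + 1) with hK
  have hK0 : 0 ≤ K := by positivity
  have htail : ∀ z : ℂ, ‖φ z‖ ≤ ‖w₀‖ / 2 →
      Summable (fun j => β (n + j) * φ z ^ j) ∧
      ‖(∑' j, β (n + j) * φ z ^ j) - β n‖ ≤ K * ‖φ z‖ := by
    intro z hz
    set q : ℝ := ‖φ z‖ * ‖w₀‖⁻¹ with hq
    have hq0 : 0 ≤ q := by positivity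
    have hq1 : q ≤ 1 / 2 := by
      rw [hq]
      calc ‖φ z‖ * ‖w₀‖⁻¹ ≤ ‖w₀‖ / 2 * ‖w₀‖⁻¹ := by gcongr
        _ = 1 / 2 := by field_simp
    have hq1' : q < 1 := by linarith
    -- domination by a geometric series
    have hdom : ∀ j, ‖β (n + j) * φ z ^ j‖ ≤ B * (‖w₀‖⁻¹) ^ n * q ^ j := by
      intro j
      rw [norm_mul, norm_pow]
      calc ‖β (n + j)‖ * ‖φ z‖ ^ j ≤ B * (‖w₀‖⁻¹) ^ (n + j) * ‖φ z‖ ^ j := by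
            gcongr; exact hcoef j
        _ = B * (‖w₀‖⁻¹) ^ n * q ^ j := by rw [hq, pow_add, mul_pow]; ring
    have hgeo : Summable fun j => B * (‖w₀‖⁻¹) ^ n * q ^ j :=
      (summable_geometric_of_lt_one hq0 hq1').mul_left _
    have hsum : Summable fun j => β (n + j) * φ z ^ j := Summable.of_norm_bounded hgeo hdom
    refine ⟨hsum, ?_⟩
    -- split off the `j = 0` term
    rw [hsum.tsum_eq_zero_add]
    simp only [add_zero, pow_zero, mul_one, add_sub_cancel_left]
    have hdom' : ∀ j, ‖β (n + (j + 1)) * φ z ^ (j + 1)‖ ≤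
        (B * (‖w₀‖⁻¹) ^ (n + 1) * ‖φ z‖) * q ^ j := by
      intro j
      rw [norm_mul, norm_pow]
      calc ‖β (n + (j + 1))‖ * ‖φ z‖ ^ (j + 1)
          ≤ B * (‖w₀‖⁻¹) ^ (n + (j + 1)) * ‖φ z‖ ^ (j + 1) := by gcongr; exact hcoef (j + 1)
        _ = (B * (‖w₀‖⁻¹) ^ (n + 1) * ‖φ z‖) * q ^ j := by
            rw [hq, mul_pow, show n + (j + 1) = (n + 1) + j by ring, pow_add, pow_add, pow_succ]
            ring
    have hgeo' : Summable fun j => (B * (‖w₀‖⁻¹) ^ (n + 1) * ‖φ z‖) * q ^ j :=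
      (summable_geometric_of_lt_one hq0 hq1').mul_left _
    calc ‖∑' j, β (n + (j + 1)) * φ z ^ (j + 1)‖
        ≤ ∑' j, ‖β (n + (j + 1)) * φ z ^ (j + 1)‖ := norm_tsum_le_tsum_norm
            ((hsum.comp_injective (add_left_injective 1)).norm)
      _ ≤ ∑' j, (B * (‖w₀‖⁻¹) ^ (n + 1) * ‖φ z‖) * q ^ j :=
            Summable.tsum_le_tsum hdom' ((hsum.comp_injective (add_left_injective 1)).norm)
              hgeo'
      _ = (B * (‖w₀‖⁻¹) ^ (n + 1) * ‖φ z‖) * (1 - q)⁻¹ := by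
            rw [tsum_mul_left, tsum_geometric_of_lt_one hq0 hq1']
      _ ≤ (B * (‖w₀‖⁻¹) ^ (n + 1) * ‖φ z‖) * 2 := by
            gcongr
            rw [inv_le_comm₀ (by linarith) (by norm_num)]
            linarith
      _ = K * ‖φ z‖ := by rw [hK]; ring
  -- `U z = φ z ^ n * T z` wherever the germ converges and `φ z` is small
  have hUeq : ∀ᶠ z in 𝓝 (0 : ℂ), U z = φ z ^ n * ∑' j, β (n + j) * φ z ^ j := by
    filter_upwards [hgerm, hsmall] with z hz hzs
    obtain ⟨hsum, -⟩ := htail z hzs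
    -- shift the germ by `n`
    have h1 : HasSum (fun j => β (j + n) * φ z ^ (j + n)) (U z - ∑ i ∈ range n, β i * φ z ^ i) :=
      (hasSum_nat_add_iff' n).mpr hz
    have h0 : ∑ i ∈ range n, β i * φ z ^ i = 0 :=
      Finset.sum_eq_zero fun i hi => by rw [hβ i (Finset.mem_range.mp hi), zero_mul]
    rw [h0, sub_zero] at h1
    have h2 : HasSum (fun j => β (n + j) * φ z ^ (n + j))
        (φ z ^ n * ∑' j, β (n + j) * φ z ^ j) := by
      have h := hsum.hasSum.mul_left (φ z ^ n)
      have hfun : (fun j => φ z ^ n * (β (n + j) * φ z ^ j)) =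
          fun j => β (n + j) * φ z ^ (n + j) := by
        funext j
        ring
      rw [hfun] at h
      exact h
    have h1' : HasSum (fun j => β (n + j) * φ z ^ (n + j)) (U z) := by
      have hfun : (fun j => β (n + j) * φ z ^ (n + j)) = fun j => β (j + n) * φ z ^ (j + n) := by
        funext j
        rw [add_comm]
      rw [hfun]
      exact h1
    exact h1'.unique h2
  -- the limit `V z / z^n → θ^n β n`
  have hslope : Tendsto (fun z : ℂ => φ z / z) (𝓝[≠] 0) (𝓝 θ) := by
    have h := hderiv.tendsto_slope_zero
    simp only [zero_add, hφ0, sub_zero, smul_eq_mul] at h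
    refine h.congr' (Eventually.of_forall fun z => ?_)
    beta_reduce
    rw [div_eq_inv_mul]
  have hT : Tendsto (fun z : ℂ => ∑' j, β (n + j) * φ z ^ j) (𝓝[≠] 0) (𝓝 (β n)) := by
    have h1 : ∀ᶠ z in 𝓝[≠] (0 : ℂ), ‖(∑' j, β (n + j) * φ z ^ j) - β n‖ ≤ K * ‖φ z‖ := by
      filter_upwards [hsmall.filter_mono nhdsWithin_le_nhds] with z hz using (htail z hz).2
    have h2 : Tendsto (fun z : ℂ => K * ‖φ z‖) (𝓝[≠] 0) (𝓝 0) := by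
      have hc : Tendsto (fun z : ℂ => K * ‖φ z‖) (𝓝 0) (𝓝 (K * ‖φ 0‖)) :=
        (hderiv.continuousAt.norm.tendsto).const_mul K
      rw [hφ0, norm_zero, mul_zero] at hc
      exact hc.mono_left nhdsWithin_le_nhds
    rw [tendsto_iff_norm_sub_tendsto_zero]
    exact squeeze_zero' (Eventually.of_forall fun z => norm_nonneg _) h1 h2
  have hlim : Tendsto (fun z => V z / z ^ n) (𝓝[≠] 0) (𝓝 (θ ^ n * β n)) := by
    have h3 : Tendsto (fun z : ℂ => (φ z / z) ^ n * ∑' j, β (n + j) * φ z ^ j) (𝓝[≠] 0)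
        (𝓝 (θ ^ n * β n)) := (hslope.pow n).mul hT
    have hw' : Tendsto w (𝓝[≠] 0) (𝓝 1) := by
      have h := hw.tendsto
      rw [hw1] at h
      exact h.mono_left nhdsWithin_le_nhds
    have h4 := hw'.mul h3
    rw [one_mul] at h4
    refine h4.congr' ?_
    filter_upwards [hUeq.filter_mono nhdsWithin_le_nhds, hVU.filter_mono nhdsWithin_le_nhds,
      self_mem_nhdsWithin] with z hz hzV hz0
    have hzn : z ^ n ≠ 0 := pow_ne_zero n hz0
    rw [hzV, hz, div_pow]
    field_simp
  -- read off the `n`-th Taylor coefficient and apply Cauchy's inequality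
  obtain ⟨-, hcoeffn⟩ := coeff_eq_of_tendsto_div_pow hp.hasFPowerSeriesAt hlim
  rw [hcoeffn, norm_mul, norm_pow] at hcoeffS
  linarith [hcoeffS, mul_comm (‖β n‖) (‖θ‖ ^ n)]


/-- **The Cauchy estimate at the lowest order** (CDT Appendix §17.3, eqs. (Cauchy bound) and
(sup bound), holomorphic case `u = h = 1`): let `β_k = 0` for `k < n`; let `φ` and `V` be
holomorphic on `|z| < R₀` (`R₀ > 1`) with `φ(0) = 0` and `V(z) = Σ_k β_k φ(z)^k` for `z` near `0`
(so `V = F ∘ φ` for `F = Σ β_k x^k`, whose leading term at `z = 0` is `φ'(0)ⁿ βₙ zⁿ`); if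
`|V| ≤ S` on the unit circle then `‖βₙ‖ · ‖φ'(0)‖ⁿ ≤ S`.
[cite: CalegariDimitrovTang2024, Appendix §17.3 eqs. (Cauchy bound), (sup bound) (p. 130)] -/
theorem norm_coeff_mul_pow_le {β : ℕ → ℂ} {n : ℕ} (hβ : ∀ k < n, β k = 0)
    {φ V : ℂ → ℂ} {R₀ : ℝ} (hR₀ : 1 < R₀)
    (hφ : DifferentiableOn ℂ φ (ball (0 : ℂ) R₀)) (hφ0 : φ 0 = 0)
    (hV : DifferentiableOn ℂ V (ball (0 : ℂ) R₀))
    (hgerm : ∀ᶠ z in 𝓝 (0 : ℂ), HasSum (fun k => β k * φ z ^ k) (V z))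
    {S : ℝ} (hS : ∀ z : ℂ, ‖z‖ = 1 → ‖V z‖ ≤ S) :
    ‖β n‖ * ‖deriv φ 0‖ ^ n ≤ S :=
  norm_coeff_mul_pow_le_of_eq_mul (U := V) (w := fun _ => 1) hβ hR₀
    (hφ.differentiableAt (ball_mem_nhds 0 (by linarith))) hφ0 hV hgerm
    (Eventually.of_forall fun z => (one_mul (V z)).symm) continuousAt_const rfl hS

end HolonomyBound

end Literature.NumberTheory.Transcendental
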